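import Literature.AlgebraicTopology.SingularHomology.CupProductSupports
import HarnessLib

/-!
# Cohomology classes of an increasing open exhaustion lift: `Hⁿ(X) → lim Hⁿ(V_m)` is onto

A. Hatcher, *Algebraic Topology* (2002), §3.F, Thm. 3F.8 and its proof (p. 313–314): for an
increasing sequence of subcomplexes (here: OPEN subsets) `V₀ ⊆ V₁ ⊆ ⋯` exhausting `X`, the
restriction maps assemble to `Hⁿ(X; G) → lim← Hⁿ(V_m; G)`, which is SURJECTIVE (the kernel is
`lim¹ Hⁿ⁻¹(V_m; G)`, Milnor's exact sequence). We prove the surjectivity half for the tree's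
singular cohomology and any coefficients, directly at cochain level and without `lim¹`:

* `SingularSimplex.exists_range_subset_of_exhaustion` — every singular simplex of `X` lies in some
  `V_m` (compact image, increasing open union; Hatcher's "compact subsets lie in finite
  subcomplexes");
* `singularCohomology.exists_forall_map_subsetIncl_eq_of_exhaustion` — **every compatible sequence
  of classes `y_m ∈ Hⁿ(↥V_m; M)` (`y_{m+1}|_{V_m} = y_m`) is the sequence of restrictions of one
  class `x ∈ Hⁿ(X; M)`.** Proof: choose representing cocycles and correct them inductively by
  coboundaries of extensions-by-zero so that they agree EXACTLY under restriction
  (`compatibleSeq`, `compatibleSeq_restrict`); an exactly compatible sequence of cocycles is the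
  sequence of restrictions of the cocycle `σ ↦ ψ_m(σ)` (`m` with `σ ⊆ V_m`; `glueSeq`).

Everything is proved; no named facts. This is the passage from finite-type to arbitrary
(countably exhausted, e.g. paracompact) bases for globally defined characteristic classes: a class
constructed compatibly on the finite unions `V_m = W₁ ∪ ⋯ ∪ W_m` of a countable trivialising cover
exists on the whole base.

## References

* A. Hatcher, *Algebraic Topology*, CUP 2002, §3.F Thm. 3F.8 (pp. 313–314); §2.1 Prop. 2.6 /
  proof of Prop. 2B.1 (compact images of simplices). [HatcherAT2002]
-/

noncomputable section

open CategoryTheory Set Function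

universe u v

namespace Literature.AlgebraicTopology.SingularHomology

variable {R : Type v} [CommRing R] {M : Type v} [AddCommGroup M] [Module R M]
variable {X : Type u} [TopologicalSpace X]

/-! ### Simplices in an exhaustion -/

/-- **Every singular simplex lies in some member of an increasing open exhaustion** (its image is
compact; Hatcher 2002, proof of Prop. 2B.1 / §3.F). [cite: HatcherAT2002, §3.F Thm. 3F.8 (proof)] -/
theorem SingularSimplex.exists_range_subset_of_exhaustion {V : ℕ → Set X} (hVo : ∀ m, IsOpen (V m))
    (hmono : Monotone V) (hV : ⋃ m, V m = univ) {n : ℕ} (σ : SingularSimplex X n) :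
    ∃ m, σ.range ⊆ V m :=
  σ.isCompact_range.elim_directed_cover V hVo (by rw [hV]; exact subset_univ _) hmono.directed_le

/-! ### Extension by zero along an inclusion of subsets -/

section Extend

variable {A B : Set X} (h : A ⊆ B)

/-- **Extension by zero** of a cochain of `↥A` to a cochain of `↥B` along `A ⊆ B` (junk `0` on the
simplices of `B` not inside `A`; Hatcher 2002, §3.1 p. 199). [cite: HatcherAT2002, §3.1 p. 199] -/
def extendZero {n : ℕ} (d : (singularCochainComplex R M A).X n) : (singularCochainComplex R M B).X n :=
  Function.extend (fun ρ : SingularSimplex A n ↦ ρ.map (ContinuousMap.inclusion h)) d 0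

/-- Restricting an extension by zero recovers the cochain. [cite: HatcherAT2002, §3.1 p. 199] -/
theorem map_inclusion_extendZero {n : ℕ} (d : (singularCochainComplex R M A).X n) :
    (singularCochainComplex.map R M (ContinuousMap.inclusion h)).f n (extendZero (R := R) h d) = d := by
  refine funext fun ρ ↦ ?_
  rw [singularCochainComplex.map_apply, extendZero]
  exact (SingularSimplex.map_injective (n := n) (f := ContinuousMap.inclusion h)
    (Set.inclusion_injective h)).extend_apply d 0 ρ

end Extend

/-! ### Exactly compatible sequences of cocycles from compatible classes -/

section Seq

variable {V : ℕ → Set X} (hmono : Monotone V)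

/-- The restriction of cochains of `↥V_{m+1}` to `↥V_m`. [folklore] -/
abbrev resSucc (m : ℕ) : singularCochainComplex R M (V (m + 1)) ⟶ singularCochainComplex R M (V m) :=
  singularCochainComplex.map R M (ContinuousMap.inclusion (hmono (Nat.le_succ m)))

/-- A cocycle of `↥V_m` representing a given class. [folklore] -/
abbrev RepOf (n m : ℕ) (y : singularCohomology R M (V m) n) : Type (max u v) :=
  {φ : (singularCochainComplex R M (V m)).X n //
    ∃ hφ : (singularCochainComplex R M (V m)).d n ((ComplexShape.up ℕ).next n) φ = 0,
      homologyCls φ hφ = y}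

variable {n : ℕ} (y : (m : ℕ) → singularCohomology R M (V m) n)
  (hy : ∀ m, singularCohomology.map R M (ContinuousMap.inclusion (hmono (Nat.le_succ m))) n
    (y (m + 1)) = y m)

include hy in
/-- **The correction step**: given a representative `ψ` of `y_m`, a representative `φ'` of
`y_{m+1}` restricting EXACTLY to `ψ` — any representative `φ` of `y_{m+1}` restricts to a cocycle
cohomologous to `ψ`, `φ| - ψ = δd`, and `φ' = φ - δ(d̃)` with `d̃` the extension of `d` by zero
(Hatcher 2002, proof of Thm. 3F.8). [cite: HatcherAT2002, §3.F Thm. 3F.8 (proof)] -/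
theorem exists_rep_restrict_eq (m : ℕ) (ψ : RepOf n m (y m)) :
    ∃ φ' : RepOf n (m + 1) (y (m + 1)), (resSucc (R := R) (M := M) hmono m).f n φ'.1 = ψ.1 := by
  obtain ⟨ψ, hψ, hψy⟩ := ψ
  obtain ⟨φ, hφ, hφy⟩ :=
    homologyCls_surjective (K := singularCochainComplex R M (V (m + 1))) (y (m + 1))
  -- `φ|` and `ψ` are cohomologous
  have hres : homologyCls ((resSucc hmono m).f n φ) (d_hom_f_eq_zero (resSucc hmono m) φ hφ) =
      homologyCls ψ hψ := by
    rw [hψy, ← hy m, ← hφy]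
    exact (homologyMap_homologyCls (resSucc hmono m) φ hφ).symm
  obtain ⟨d, hd⟩ := (homologyCls_eq_homologyCls_iff _ _ _ _).1 hres
  -- correct `φ` by the coboundary of the extension by zero of `d`
  let d' : (singularCochainComplex R M (V (m + 1))).X ((ComplexShape.up ℕ).prev n) :=
    extendZero (R := R) (hmono (Nat.le_succ m)) d
  have hd' : (resSucc (R := R) (M := M) hmono m).f _ d' = d := map_inclusion_extendZero _ d
  have hdφ : (singularCochainComplex R M (V (m + 1))).d n ((ComplexShape.up ℕ).next n)
      (φ - (singularCochainComplex R M (V (m + 1))).d _ n d') = 0 := by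
    rw [map_sub, hφ, ← ModuleCat.comp_apply, HomologicalComplex.d_comp_d, zero_sub, neg_eq_zero]
    rfl
  refine ⟨⟨φ - (singularCochainComplex R M (V (m + 1))).d _ n d', hdφ, ?_⟩, ?_⟩
  · rw [← hφy, homologyCls_eq_homologyCls_iff]
    exact ⟨-d', by rw [map_neg]; abel⟩
  · change (resSucc hmono m).f n (φ - (singularCochainComplex R M (V (m + 1))).d _ n d') = ψ
    rw [map_sub, ← ModuleCat.comp_apply, ← (resSucc (R := R) (M := M) hmono m).comm,
      ModuleCat.comp_apply, hd', hd]
    abel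

/-- **An exactly compatible sequence of representatives** of the compatible classes `y_m`
(recursively corrected; Hatcher 2002, proof of Thm. 3F.8). [cite: HatcherAT2002, §3.F Thm. 3F.8 (proof)] -/
def compatibleSeq : (m : ℕ) → RepOf n m (y m)
  | 0 => ⟨(homologyCls_surjective (K := singularCochainComplex R M (V 0)) (y 0)).choose,
      (homologyCls_surjective (K := singularCochainComplex R M (V 0)) (y 0)).choose_spec⟩
  | m + 1 => (exists_rep_restrict_eq hmono y hy m (compatibleSeq m)).choose

/-- The sequence is exactly compatible under restriction. [cite: HatcherAT2002, §3.F Thm. 3F.8 (proof)] -/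
theorem compatibleSeq_restrict (m : ℕ) :
    (resSucc (R := R) (M := M) hmono m).f n (compatibleSeq hmono y hy (m + 1)).1 =
      (compatibleSeq hmono y hy m).1 :=
  (exists_rep_restrict_eq hmono y hy m (compatibleSeq hmono y hy m)).choose_spec

end Seq

/-! ### Gluing an exactly compatible sequence of cocycles -/

section GlueSeq

variable {V : ℕ → Set X} (hVo : ∀ m, IsOpen (V m)) (hmono : Monotone V) (hV : ⋃ m, V m = univ)
  {n : ℕ} (ψ : (m : ℕ) → (singularCochainComplex R M (V m)).X n)
  (hψ : ∀ m, (singularCochainComplex.map R M (ContinuousMap.inclusion (hmono (Nat.le_succ m)))).f n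
    (ψ (m + 1)) = ψ m)

include hψ in
/-- Iterated compatibility: `ψ_{m'}` restricted to `V_m` is `ψ_m` for `m ≤ m'`. [folklore] -/
theorem seq_map_inclusion_of_le {m m' : ℕ} (hle : m ≤ m') (ρ : SingularSimplex (V m) n) :
    ψ m' (ρ.map (ContinuousMap.inclusion (hmono hle))) = ψ m ρ := by
  induction hle with
  | refl =>
    have h0 : ContinuousMap.inclusion (hmono (le_refl m)) = ContinuousMap.id (V m) := by
      ext x; rfl
    rw [h0, SingularSimplex.map_id]
  | @step k hk ih =>
    have hcomp : ρ.map (ContinuousMap.inclusion (hmono (Nat.le_succ_of_le hk))) =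
        (ρ.map (ContinuousMap.inclusion (hmono hk))).map
          (ContinuousMap.inclusion (hmono (Nat.le_succ k))) := by
      rw [← SingularSimplex.map_comp]
      rfl
    have h1 := congrFun (hψ k) (ρ.map (ContinuousMap.inclusion (hmono hk)))
    rw [singularCochainComplex.map_apply] at h1
    rw [hcomp, h1, ih]

open scoped Classical in
/-- The first member of the exhaustion containing a simplex. [folklore] -/
def levelOf {k : ℕ} (σ : SingularSimplex X k) : ℕ :=
  Nat.find (SingularSimplex.exists_range_subset_of_exhaustion hVo hmono hV σ)

open scoped Classical in
/-- The simplex lies in its level. [folklore] -/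
theorem range_subset_levelOf {k : ℕ} (σ : SingularSimplex X k) : σ.range ⊆ V (levelOf hVo hmono hV σ) :=
  Nat.find_spec (SingularSimplex.exists_range_subset_of_exhaustion hVo hmono hV σ)

open scoped Classical in
/-- The level is minimal. [folklore] -/
theorem levelOf_le {k : ℕ} (σ : SingularSimplex X k) {m : ℕ} (h : σ.range ⊆ V m) :
    levelOf hVo hmono hV σ ≤ m :=
  Nat.find_min' _ h

/-- **The glued cochain** `σ ↦ ψ_{m(σ)}(σ|)` of an exactly compatible sequence of cochains on an
exhaustion. [cite: HatcherAT2002, §3.F Thm. 3F.8 (proof)] -/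
def glueSeq : (singularCochainComplex R M X).X n :=
  fun σ : SingularSimplex X n ↦ ψ (levelOf hVo hmono hV σ)
    (SingularSimplex.codRestrict σ (V _) (range_subset_levelOf hVo hmono hV σ))

include hψ in
/-- The glued cochain on a simplex inside `V_m` is `ψ_m` of that simplex (any `m`).
[cite: HatcherAT2002, §3.F Thm. 3F.8 (proof)] -/
theorem glueSeq_apply (σ : SingularSimplex X n) {m : ℕ} (h : σ.range ⊆ V m) :
    glueSeq (R := R) hVo hmono hV ψ σ = ψ m (SingularSimplex.codRestrict σ (V m) h) := by
  have hle : levelOf hVo hmono hV σ ≤ m := levelOf_le hVo hmono hV σ h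
  have hmap : SingularSimplex.codRestrict σ (V m) h =
      (SingularSimplex.codRestrict σ (V _) (range_subset_levelOf hVo hmono hV σ)).map
        (ContinuousMap.inclusion (hmono hle)) := by
    apply SingularSimplex.map_injective (f := subsetIncl (V m)) Subtype.val_injective
    change (SingularSimplex.codRestrict σ (V m) h).map (subsetIncl (V m)) =
      ((SingularSimplex.codRestrict σ (V _) (range_subset_levelOf hVo hmono hV σ)).map
        (ContinuousMap.inclusion (hmono hle))).map (subsetIncl (V m))
    rw [SingularSimplex.codRestrict_map_val, ← SingularSimplex.map_comp]
    exact (SingularSimplex.codRestrict_map_val σ _ _).symm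
  rw [hmap, seq_map_inclusion_of_le (R := R) hmono ψ hψ hle]
  rfl

include hψ in
/-- **The coboundary of the glued cochain is the glueing of the coboundaries** (faces stay inside
`V_m`). [cite: HatcherAT2002, §3.F Thm. 3F.8 (proof)] -/
theorem d_glueSeq_apply (σ : SingularSimplex X (n + 1)) {m : ℕ} (h : σ.range ⊆ V m) :
    (singularCochainComplex R M X).d n (n + 1) (glueSeq hVo hmono hV ψ) σ =
      (singularCochainComplex R M (V m)).d n (n + 1) (ψ m) (SingularSimplex.codRestrict σ (V m) h) := by
  rw [singularCochainComplex.d_apply, singularCochainComplex.d_apply]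
  refine Finset.sum_congr rfl fun i _ ↦ ?_
  rw [SingularSimplex.codRestrict_face, glueSeq_apply hVo hmono hV ψ hψ _ ((σ.range_face_subset i).trans h)]

include hψ in
/-- Restricting the glued cochain to `V_m` recovers `ψ_m`. [cite: HatcherAT2002, §3.F Thm. 3F.8 (proof)] -/
theorem map_subsetIncl_glueSeq (m : ℕ) :
    (singularCochainComplex.map R M (subsetIncl (V m))).f n (glueSeq hVo hmono hV ψ) = ψ m := by
  refine funext fun τ ↦ ?_
  rw [singularCochainComplex.map_apply,
    glueSeq_apply hVo hmono hV ψ hψ _ (SingularSimplex.range_map_val_subset (V m) τ)]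
  exact congrArg (ψ m) (SingularSimplex.map_injective (f := subsetIncl (V m)) Subtype.val_injective
    (SingularSimplex.codRestrict_map_val _ _ _))

include hψ in
/-- The glueing of cocycles is a cocycle. [cite: HatcherAT2002, §3.F Thm. 3F.8 (proof)] -/
theorem d_glueSeq_eq_zero
    (hcoc : ∀ m, (singularCochainComplex R M (V m)).d n ((ComplexShape.up ℕ).next n) (ψ m) = 0) :
    (singularCochainComplex R M X).d n ((ComplexShape.up ℕ).next n) (glueSeq hVo hmono hV ψ) = 0 := by
  have hnext : (ComplexShape.up ℕ).next n = n + 1 := CochainComplex.next ℕ n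
  rw [hnext]
  refine funext fun σ ↦ ?_
  rw [d_glueSeq_apply hVo hmono hV ψ hψ σ (range_subset_levelOf hVo hmono hV σ)]
  have := hcoc (levelOf hVo hmono hV σ)
  rw [hnext] at this
  rw [this]
  rfl

end GlueSeq

/-! ### The lifting theorem -/

namespace singularCohomology

/-- **Compatible sequences of classes on an increasing open exhaustion lift to the whole space**
(the surjectivity of `Hⁿ(X; M) → lim← Hⁿ(V_m; M)`, Hatcher 2002, Thm. 3F.8): if
`V₀ ⊆ V₁ ⊆ ⋯` are open with `⋃ V_m = X` and `y_m ∈ Hⁿ(↥V_m; M)` satisfy `y_{m+1}|_{V_m} = y_m`,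
there is `x ∈ Hⁿ(X; M)` with `x|_{V_m} = y_m` for all `m`. [cite: HatcherAT2002, §3.F Thm. 3F.8] -/
theorem exists_forall_map_subsetIncl_eq_of_exhaustion {V : ℕ → Set X} (hVo : ∀ m, IsOpen (V m))
    (hmono : Monotone V) (hV : ⋃ m, V m = univ) {n : ℕ}
    (y : (m : ℕ) → singularCohomology R M (V m) n)
    (hy : ∀ m, singularCohomology.map R M (ContinuousMap.inclusion (hmono (Nat.le_succ m))) n
      (y (m + 1)) = y m) :
    ∃ x : singularCohomology R M X n, ∀ m, singularCohomology.map R M (subsetIncl (V m)) n x = y m := by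
  -- exactly compatible representatives
  let ψ : (m : ℕ) → (singularCochainComplex R M (V m)).X n := fun m ↦ (compatibleSeq hmono y hy m).1
  have hψ : ∀ m, (singularCochainComplex.map R M (ContinuousMap.inclusion (hmono (Nat.le_succ m)))).f n
      (ψ (m + 1)) = ψ m := fun m ↦ compatibleSeq_restrict hmono y hy m
  have hcoc : ∀ m, ∃ hφ : (singularCochainComplex R M (V m)).d n ((ComplexShape.up ℕ).next n) (ψ m) = 0,
      homologyCls (ψ m) hφ = y m := fun m ↦ (compatibleSeq hmono y hy m).2
  choose hφ hcls using hcoc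
  refine ⟨homologyCls (K := singularCochainComplex R M X) (glueSeq hVo hmono hV ψ)
    (d_glueSeq_eq_zero hVo hmono hV ψ hψ hφ), fun m ↦ ?_⟩
  rw [← hcls m]
  exact (homologyMap_homologyCls _ _ _).trans
    (homologyCls_congr (map_subsetIncl_glueSeq (R := R) hVo hmono hV ψ hψ m) _ _)

end singularCohomology

end Literature.AlgebraicTopology.SingularHomology
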